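import Summits.CriticalPhenomena.Ising3D.TaylorSigmaDelta
import Summits.CriticalPhenomena.Ising3D.TaylorRegionBoxInputs
import Mathlib.Tactic.Linarith
import Mathlib.Tactic.Positivity
import Mathlib.Tactic.Ring
import HarnessLib

/-!
# The kernel with GENERIC coefficient functions in its two factors, its `(P, D)` tables, and the δ-expanded kernel as
three tables (item (L2) of the box-width-robust region rows; HOME/pub-ising3x-recog-1/gen12/REGION-ON-MARGIN-FUNCTIONAL.md §5)
(cell `pub-ising3x`, seat recog-1 gen 12; gate (g2))

HONEST FRAMING: lottery ticket; floor = tightest certified 3D Ising CFT bounds; no exact-solution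
claim without a proof. Island framing: certified exclusion region at stated derivative order and
assumptions; not a determination of the 3D Ising critical exponents beyond that.

The even kernel `K_c(u,v) = Σ c(a,b) 2^{a+b} (1 + σ(-1)^{a+b}) q¹(s,u;a) q¹(s,v;b)` depends on the exponent `s` only through
the numbers `σ_i(s) = (-1)^i C(s,i)` inside `q¹(s,x;a) = Σ_i σ_i(s) C(x, a−i)`, LINEARLY in each factor. This file makes the
two coefficient functions arguments: `qFactorG σ x a`, `evenKernelG c S σ₁ σ₂ σ u v` (= the tree's `evenKernel` when
`σ₁ = σ₂ = σ(s)`, `evenKernel_eq_evenKernelG`), the bilinear δ-EXPANSION **`evenKernelG_delta`** (from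
`σ_i = C0_i + δ C1_i + δ² ρ_i`), the real `(P, D)` tables `kernelPDRowG` / **`kernelPDLG`** with **`eval2_kernelPDLG`**, their
interval twins `kernelPDRowI2` / **`kernelPDLI2`** (the landed `kernelPDRowI` with different coefficient functions in the two
factors) with **`pmem2_kernelPDLI2`**, and the package for a box `s ∈ [s₀ − W, s₀ + W]`: interval tables **`deltaT0 / deltaT1 /
deltaT2`** (from `TaylorSigmaDelta`'s `sigmaC0 / sigmaC1 / sigmaRemB`), real shadows, memberships, and
**`evenKernel_eq_eval2_delta`**: `K_c[s₀ + δ](u,v) = eval2 T₀ + δ · eval2 T₁ + δ² · eval2 T₂(δ)` at `(u+v−cc, u−v)`.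
The rows, piece tests and the region assembly on these tables are item (L3). Elementary. [folklore]
-/

namespace Summit.CriticalPhenomena.Ising3D

open Finset
open Literature.Analysis.ValidatedNumerics Literature.Analysis.ValidatedNumerics.PolyMP
open Literature.Analysis.ValidatedNumerics.NumericsMP (MI)
open Literature.MathematicalPhysics.QuantumFieldTheory.ConformalBootstrap3D

/-! ### Generic q-factor -/

/-- `Σ_{i ≤ a} σ(i) · C(x, a − i)` — the q-factor with a generic coefficient function. [folklore] -/
noncomputable def qFactorG (σ : ℕ → ℝ) (x : ℝ) (a : ℕ) : ℝ := ∑ i ∈ range (a + 1), σ i * Ring.choose x (a - i)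

/-- Its coefficient list in `x`. [folklore] -/
noncomputable def qFactorGList (σ : ℕ → ℝ) (a : ℕ) : List ℝ :=
  sumR (fun i => smulR (σ i) (chooseCoeffList (a - i))) (a + 1)

/-- [folklore] -/
theorem evalR_qFactorGList (σ : ℕ → ℝ) (a : ℕ) (x : ℝ) : evalR (qFactorGList σ a) x = qFactorG σ x a := by
  rw [qFactorGList, evalR_sumR, qFactorG]
  exact sum_congr rfl fun i _ => by rw [evalR_smulR, evalR_chooseCoeffList]

/-- The tree's `q¹(s, x; a)` is the generic q-factor of `σ(s)`. [folklore] -/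
theorem qFactor₁_eq_qFactorG (s x : ℝ) (a : ℕ) :
    qFactor₁ s x a = qFactorG (fun i => (-1) ^ i * Ring.choose s i) x a := by
  rw [qFactor₁, qFactorG, Finset.Nat.sum_antidiagonal_eq_sum_range_succ_mk]

/-- **Linearity → the δ-split of the q-factor.** [folklore] -/
theorem qFactorG_delta {σ C0 C1 ρ : ℕ → ℝ} {δ : ℝ} (h : ∀ i, σ i = C0 i + δ * C1 i + δ ^ 2 * ρ i) (x : ℝ) (a : ℕ) :
    qFactorG σ x a = qFactorG C0 x a + δ * qFactorG C1 x a + δ ^ 2 * qFactorG ρ x a := by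
  simp only [qFactorG, h, add_mul, sum_add_distrib, mul_assoc, mul_sum]

/-! ### Generic kernel -/

/-- One `(a,b)` term of the generic kernel. [folklore] -/
noncomputable def termG (c : ℕ × ℕ → ℝ) (σ₁ σ₂ : ℕ → ℝ) (sg u v : ℝ) (ab : ℕ × ℕ) : ℝ :=
  c ab * 2 ^ (ab.1 + ab.2) * (1 + sg * (-1) ^ (ab.1 + ab.2)) * (qFactorG σ₁ u ab.1 * qFactorG σ₂ v ab.2)

/-- `K^G_c[σ₁, σ₂](u,v) = Σ_{(a,b)∈S} c(a,b) 2^{a+b} (1 + σ(-1)^{a+b}) q_{σ₁}(u;a) q_{σ₂}(v;b)`. [folklore] -/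
noncomputable def evenKernelG (c : ℕ × ℕ → ℝ) (S : Finset (ℕ × ℕ)) (σ₁ σ₂ : ℕ → ℝ) (sg u v : ℝ) : ℝ :=
  ∑ ab ∈ S, termG c σ₁ σ₂ sg u v ab

/-- **The tree's kernel is the generic kernel at `σ₁ = σ₂ = σ(s)`.** [folklore] -/
theorem evenKernel_eq_evenKernelG (c : ℕ × ℕ → ℝ) (S : Finset (ℕ × ℕ)) (s sg u v : ℝ) :
    evenKernel c S s sg u v =
      evenKernelG c S (fun i => (-1) ^ i * Ring.choose s i) (fun i => (-1) ^ i * Ring.choose s i) sg u v := by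
  unfold evenKernel evenKernelG termG
  simp_rw [qFactor₁_eq_qFactorG]

/-- [folklore] -/
theorem termG_delta {σ C0 C1 ρ : ℕ → ℝ} {δ : ℝ} (h : ∀ i, σ i = C0 i + δ * C1 i + δ ^ 2 * ρ i)
    (c : ℕ × ℕ → ℝ) (sg u v : ℝ) (ab : ℕ × ℕ) :
    termG c σ σ sg u v ab = termG c C0 C0 sg u v ab + δ * (termG c C1 C0 sg u v ab + termG c C0 C1 sg u v ab) +
      δ ^ 2 * (termG c C1 C1 sg u v ab + termG c C0 ρ sg u v ab + termG c ρ C0 sg u v ab +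
        δ * (termG c C1 ρ sg u v ab + termG c ρ C1 sg u v ab) + δ ^ 2 * termG c ρ ρ sg u v ab) := by
  simp only [termG, qFactorG_delta h]
  ring

/-- **δ-expansion of the kernel** (bilinear in the two coefficient functions). [folklore] -/
theorem evenKernelG_delta {σ C0 C1 ρ : ℕ → ℝ} {δ : ℝ} (h : ∀ i, σ i = C0 i + δ * C1 i + δ ^ 2 * ρ i)
    (c : ℕ × ℕ → ℝ) (S : Finset (ℕ × ℕ)) (sg u v : ℝ) :
    evenKernelG c S σ σ sg u v =
      evenKernelG c S C0 C0 sg u v + δ * (evenKernelG c S C1 C0 sg u v + evenKernelG c S C0 C1 sg u v) +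
        δ ^ 2 * (evenKernelG c S C1 C1 sg u v + evenKernelG c S C0 ρ sg u v + evenKernelG c S ρ C0 sg u v +
          δ * (evenKernelG c S C1 ρ sg u v + evenKernelG c S ρ C1 sg u v) + δ ^ 2 * evenKernelG c S ρ ρ sg u v) := by
  unfold evenKernelG
  rw [sum_congr rfl fun ab _ => termG_delta h c sg u v ab]
  simp only [sum_add_distrib, ← mul_sum]

/-! ### Real `(P, D)` tables of the generic kernel -/

/-- The `(a,b)`-term as a bivariate coefficient list in `(P, D) = (u + v − cc, u − v)`. [folklore] -/
noncomputable def kernelPDRowG (c : ℕ × ℕ → ℝ) (σ₁ σ₂ : ℕ → ℝ) (sg cc : ℝ) (ab : ℕ × ℕ) : List (List ℝ) :=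
  smul2 (c ab * 2 ^ (ab.1 + ab.2) * (1 + sg * (-1) ^ (ab.1 + ab.2)))
    (mul2 (shift2 (affineR (qFactorGList σ₁ ab.1) (1 / 2) (cc / 2)))
      (altY (shift2 (affineR (qFactorGList σ₂ ab.2) (1 / 2) (cc / 2)))))

/-- [folklore] -/
theorem eval2_kernelPDRowG (c : ℕ × ℕ → ℝ) (σ₁ σ₂ : ℕ → ℝ) (sg cc : ℝ) (ab : ℕ × ℕ) (u v : ℝ) :
    eval2 (kernelPDRowG c σ₁ σ₂ sg cc ab) (u + v - cc) (u - v) = termG c σ₁ σ₂ sg u v ab := by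
  rw [kernelPDRowG, eval2_smul2, eval2_mul2, eval2_shift2, eval2_altY, eval2_shift2, evalR_affineR, evalR_affineR,
    evalR_qFactorGList, evalR_qFactorGList, termG]
  have hu : 1 / 2 * (u + v - cc + (u - v)) + cc / 2 = u := by ring
  have hv : 1 / 2 * (u + v - cc + -(u - v)) + cc / 2 = v := by ring
  rw [hu, hv]

/-- The generic kernel's table over an index list. [folklore] -/
noncomputable def kernelPDLG (c : ℕ × ℕ → ℝ) (l : List (ℕ × ℕ)) (σ₁ σ₂ : ℕ → ℝ) (sg cc : ℝ) : List (List ℝ) :=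
  sumList2 l (kernelPDRowG c σ₁ σ₂ sg cc)

/-- **`eval2 (kernelPDLG c l σ₁ σ₂ …) (u+v−cc) (u−v) = K^G(u,v)`** (`l` duplicate-free). [folklore] -/
theorem eval2_kernelPDLG (c : ℕ × ℕ → ℝ) {l : List (ℕ × ℕ)} (hl : l.Nodup) (σ₁ σ₂ : ℕ → ℝ) (sg cc u v : ℝ) :
    eval2 (kernelPDLG c l σ₁ σ₂ sg cc) (u + v - cc) (u - v) = evenKernelG c l.toFinset σ₁ σ₂ sg u v := by
  rw [kernelPDLG, eval2_sumList2_toFinset _ _ _ hl, evenKernelG]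
  exact sum_congr rfl fun ab _ => eval2_kernelPDRowG c σ₁ σ₂ sg cc ab u v

/-! ### Interval twins with two coefficient functions -/

/-- [folklore] -/
theorem pmem_qFactorGListI {S : ℕ} (hS : 0 < S) {σ : ℕ → ℝ} {C : ℕ → MI} {a : ℕ}
    (hC : ∀ i, i ≤ a → MI.mem S (σ i) (C i)) : PMem S (qFactorGList σ a) (qFactor₁ListI S C a) :=
  pmem_sumI (a + 1) fun i hi => pmem_smulI hS (hC i (Nat.lt_succ_iff.mp hi)) (pmem_chooseCoeffListI S _)

/-- Interval twin of `kernelPDRowG (↑cQ) σ₁ σ₂ σQ ccQ ab` from enclosures `C₁ ∋ σ₁`, `C₂ ∋ σ₂`. [folklore] -/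
def kernelPDRowI2 (S : ℕ) (cQ : ℕ × ℕ → ℚ) (σQ : ℚ) (C₁ C₂ : ℕ → MI) (ccQ : ℚ) (ab : ℕ × ℕ) : IPoly2 :=
  smul2QI (cQ ab * 2 ^ (ab.1 + ab.2) * (1 + σQ * (-1) ^ (ab.1 + ab.2)))
    (mul2I S (shift2I S (affineI S (qFactor₁ListI S C₁ ab.1) (PolyMP.ofRat S (1 / 2)) (PolyMP.ofRat S (ccQ / 2))))
      (altYI (shift2I S (affineI S (qFactor₁ListI S C₂ ab.2) (PolyMP.ofRat S (1 / 2)) (PolyMP.ofRat S (ccQ / 2))))))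

/-- [folklore] -/
theorem pmem2_kernelPDRowI2 {S : ℕ} (hS : 0 < S) {σ₁ σ₂ : ℕ → ℝ} {C₁ C₂ : ℕ → MI} (cQ : ℕ × ℕ → ℚ) (σQ ccQ : ℚ)
    (ab : ℕ × ℕ) (hC₁ : ∀ i, i ≤ ab.1 → MI.mem S (σ₁ i) (C₁ i)) (hC₂ : ∀ i, i ≤ ab.2 → MI.mem S (σ₂ i) (C₂ i)) :
    PMem2 S (kernelPDRowG (fun ab => (cQ ab : ℝ)) σ₁ σ₂ (σQ : ℝ) (ccQ : ℝ) ab) (kernelPDRowI2 S cQ σQ C₁ C₂ ccQ ab) := by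
  have hhalf : MI.mem S (1 / 2 : ℝ) (PolyMP.ofRat S (1 / 2)) := by
    have h := mem_ofRat S (1 / 2 : ℚ); push_cast at h; exact h
  have hcc : MI.mem S ((ccQ : ℝ) / 2) (PolyMP.ofRat S (ccQ / 2)) := by
    have h := mem_ofRat S (ccQ / 2); push_cast at h; exact h
  unfold kernelPDRowG kernelPDRowI2
  refine pmem2_smul2QI _ (by push_cast; ring) (pmem2_mul2I hS ?_ ?_)
  · exact pmem2_shift2I (pmem_affineI hS hhalf hcc (pmem_qFactorGListI hS hC₁))
  · exact pmem2_altYI (pmem2_shift2I (pmem_affineI hS hhalf hcc (pmem_qFactorGListI hS hC₂)))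

/-- Interval twin of `kernelPDLG`. With `C₁ = C₂` it is the landed `kernelPDLI` (`kernelPDLI2_self`). [folklore] -/
def kernelPDLI2 (S : ℕ) (cQ : ℕ × ℕ → ℚ) (σQ : ℚ) (C₁ C₂ : ℕ → MI) (ccQ : ℚ) (l : List (ℕ × ℕ)) : IPoly2 :=
  sumList2I l (kernelPDRowI2 S cQ σQ C₁ C₂ ccQ)

/-- [folklore] -/
theorem kernelPDLI2_self (S : ℕ) (cQ : ℕ × ℕ → ℚ) (σQ : ℚ) (C : ℕ → MI) (ccQ : ℚ) (l : List (ℕ × ℕ)) :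
    kernelPDLI2 S cQ σQ C C ccQ l = kernelPDLI S cQ σQ C ccQ l := rfl

/-- **`PMem2 S (kernelPDLG (↑cQ) l σ₁ σ₂ σQ ccQ) (kernelPDLI2 S cQ σQ C₁ C₂ ccQ l)`** from `C₁ ∋ σ₁`, `C₂ ∋ σ₂`. [folklore] -/
theorem pmem2_kernelPDLI2 {S : ℕ} (hS : 0 < S) {σ₁ σ₂ : ℕ → ℝ} {C₁ C₂ : ℕ → MI} (cQ : ℕ × ℕ → ℚ) (σQ ccQ : ℚ)
    (l : List (ℕ × ℕ)) (hC₁ : ∀ i, MI.mem S (σ₁ i) (C₁ i)) (hC₂ : ∀ i, MI.mem S (σ₂ i) (C₂ i)) :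
    PMem2 S (kernelPDLG (fun ab => (cQ ab : ℝ)) l σ₁ σ₂ (σQ : ℝ) (ccQ : ℝ)) (kernelPDLI2 S cQ σQ C₁ C₂ ccQ l) :=
  pmem2_sumList2I l fun ab _ => pmem2_kernelPDRowI2 hS cQ σQ ccQ ab (fun i _ => hC₁ i) (fun i _ => hC₂ i)

/-! ### The δ-expanded kernel as three tables (box `s ∈ [s₀ − W, s₀ + W]`) -/

/-- The real coefficient functions of the split. [folklore] -/
noncomputable def sigC0 (s₀ : ℚ) (i : ℕ) : ℝ := (((sigmaDeltaQ s₀ i).getD 0 0 : ℚ) : ℝ)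
/-- [folklore] -/
noncomputable def sigC1 (s₀ : ℚ) (i : ℕ) : ℝ := (((sigmaDeltaQ s₀ i).getD 1 0 : ℚ) : ℝ)

/-- Order-0 table (point tables at the box centre; thin intervals). [folklore] -/
def deltaT0 (S : ℕ) (cQ : ℕ × ℕ → ℚ) (σQ : ℚ) (s₀ ccQ : ℚ) (l : List (ℕ × ℕ)) : IPoly2 :=
  kernelPDLI2 S cQ σQ (sigmaC0 S s₀) (sigmaC0 S s₀) ccQ l

/-- Order-1 table. [folklore] -/
def deltaT1 (S : ℕ) (cQ : ℕ × ℕ → ℚ) (σQ : ℚ) (s₀ ccQ : ℚ) (l : List (ℕ × ℕ)) : IPoly2 :=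
  add2I (kernelPDLI2 S cQ σQ (sigmaC1 S s₀) (sigmaC0 S s₀) ccQ l) (kernelPDLI2 S cQ σQ (sigmaC0 S s₀) (sigmaC1 S s₀) ccQ l)

/-- Second-order (remainder) table: an interval enclosure valid for every `|δ| ≤ W`. [folklore] -/
def deltaT2 (S : ℕ) (cQ : ℕ × ℕ → ℚ) (σQ : ℚ) (s₀ W ccQ : ℚ) (l : List (ℕ × ℕ)) : IPoly2 :=
  add2I
    (add2I (kernelPDLI2 S cQ σQ (sigmaC1 S s₀) (sigmaC1 S s₀) ccQ l)
      (add2I (kernelPDLI2 S cQ σQ (sigmaC0 S s₀) (sigmaRemB S s₀ W) ccQ l)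
        (kernelPDLI2 S cQ σQ (sigmaRemB S s₀ W) (sigmaC0 S s₀) ccQ l)))
    (add2I
      (smul2MI S (enclQ S (-W) W)
        (add2I (kernelPDLI2 S cQ σQ (sigmaC1 S s₀) (sigmaRemB S s₀ W) ccQ l)
          (kernelPDLI2 S cQ σQ (sigmaRemB S s₀ W) (sigmaC1 S s₀) ccQ l)))
      (smul2MI S (enclQ S 0 (W ^ 2)) (kernelPDLI2 S cQ σQ (sigmaRemB S s₀ W) (sigmaRemB S s₀ W) ccQ l)))

/-- Real shadow of `deltaT0`. [folklore] -/
noncomputable def deltaT0R (cQ : ℕ × ℕ → ℚ) (σQ : ℚ) (s₀ ccQ : ℚ) (l : List (ℕ × ℕ)) : List (List ℝ) :=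
  kernelPDLG (fun ab => (cQ ab : ℝ)) l (sigC0 s₀) (sigC0 s₀) (σQ : ℝ) (ccQ : ℝ)

/-- Real shadow of `deltaT1`. [folklore] -/
noncomputable def deltaT1R (cQ : ℕ × ℕ → ℚ) (σQ : ℚ) (s₀ ccQ : ℚ) (l : List (ℕ × ℕ)) : List (List ℝ) :=
  add2 (kernelPDLG (fun ab => (cQ ab : ℝ)) l (sigC1 s₀) (sigC0 s₀) (σQ : ℝ) (ccQ : ℝ))
    (kernelPDLG (fun ab => (cQ ab : ℝ)) l (sigC0 s₀) (sigC1 s₀) (σQ : ℝ) (ccQ : ℝ))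

/-- Real shadow of `deltaT2` at a given `δ`. [folklore] -/
noncomputable def deltaT2R (cQ : ℕ × ℕ → ℚ) (σQ : ℚ) (s₀ ccQ : ℚ) (l : List (ℕ × ℕ)) (δ : ℝ) : List (List ℝ) :=
  add2
    (add2 (kernelPDLG (fun ab => (cQ ab : ℝ)) l (sigC1 s₀) (sigC1 s₀) (σQ : ℝ) (ccQ : ℝ))
      (add2 (kernelPDLG (fun ab => (cQ ab : ℝ)) l (sigC0 s₀) (sigmaRho s₀ · δ) (σQ : ℝ) (ccQ : ℝ))
        (kernelPDLG (fun ab => (cQ ab : ℝ)) l (sigmaRho s₀ · δ) (sigC0 s₀) (σQ : ℝ) (ccQ : ℝ))))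
    (add2
      (smul2 δ
        (add2 (kernelPDLG (fun ab => (cQ ab : ℝ)) l (sigC1 s₀) (sigmaRho s₀ · δ) (σQ : ℝ) (ccQ : ℝ))
          (kernelPDLG (fun ab => (cQ ab : ℝ)) l (sigmaRho s₀ · δ) (sigC1 s₀) (σQ : ℝ) (ccQ : ℝ))))
      (smul2 (δ ^ 2) (kernelPDLG (fun ab => (cQ ab : ℝ)) l (sigmaRho s₀ · δ) (sigmaRho s₀ · δ) (σQ : ℝ) (ccQ : ℝ))))

/-- [folklore] -/
theorem pmem2_deltaT0 {S : ℕ} (hS : 0 < S) (cQ : ℕ × ℕ → ℚ) (σQ : ℚ) (s₀ ccQ : ℚ) (l : List (ℕ × ℕ)) :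
    PMem2 S (deltaT0R cQ σQ s₀ ccQ l) (deltaT0 S cQ σQ s₀ ccQ l) :=
  pmem2_kernelPDLI2 hS cQ σQ ccQ l (mem_sigmaC0 S s₀) (mem_sigmaC0 S s₀)

/-- [folklore] -/
theorem pmem2_deltaT1 {S : ℕ} (hS : 0 < S) (cQ : ℕ × ℕ → ℚ) (σQ : ℚ) (s₀ ccQ : ℚ) (l : List (ℕ × ℕ)) :
    PMem2 S (deltaT1R cQ σQ s₀ ccQ l) (deltaT1 S cQ σQ s₀ ccQ l) :=
  pmem2_add2I (pmem2_kernelPDLI2 hS cQ σQ ccQ l (mem_sigmaC1 S s₀) (mem_sigmaC0 S s₀))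
    (pmem2_kernelPDLI2 hS cQ σQ ccQ l (mem_sigmaC0 S s₀) (mem_sigmaC1 S s₀))

/-- [folklore] -/
theorem pmem2_deltaT2 {S : ℕ} (hS : 0 < S) (cQ : ℕ × ℕ → ℚ) (σQ : ℚ) (s₀ : ℚ) {W : ℚ} (hW : 0 ≤ W) (ccQ : ℚ)
    (l : List (ℕ × ℕ)) {δ : ℝ} (hδ : |δ| ≤ W) :
    PMem2 S (deltaT2R cQ σQ s₀ ccQ l δ) (deltaT2 S cQ σQ s₀ W ccQ l) := by
  have hρ : ∀ i, MI.mem S (sigmaRho s₀ i δ) (sigmaRemB S s₀ W i) := fun i => mem_sigmaRemB S s₀ hW i hδ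
  have h0 := mem_sigmaC0 S s₀
  have h1 := mem_sigmaC1 S s₀
  have hδI : MI.mem S δ (enclQ S (-W) W) :=
    mem_enclQ S (by push_cast; linarith [neg_abs_le δ, hδ, (abs_le.mp hδ).1]) (by linarith [le_abs_self δ])
  have hδ2 : MI.mem S (δ ^ 2) (enclQ S 0 (W ^ 2)) := by
    refine mem_enclQ S (by push_cast; positivity) ?_
    have : δ ^ 2 ≤ (W : ℝ) ^ 2 := by
      rw [← sq_abs]; exact pow_le_pow_left₀ (abs_nonneg δ) hδ 2
    exact_mod_cast this
  unfold deltaT2R deltaT2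
  exact pmem2_add2I
    (pmem2_add2I (pmem2_kernelPDLI2 hS cQ σQ ccQ l h1 h1)
      (pmem2_add2I (pmem2_kernelPDLI2 hS cQ σQ ccQ l h0 hρ) (pmem2_kernelPDLI2 hS cQ σQ ccQ l hρ h0)))
    (pmem2_add2I
      (pmem2_smul2MI hS hδI
        (pmem2_add2I (pmem2_kernelPDLI2 hS cQ σQ ccQ l h1 hρ) (pmem2_kernelPDLI2 hS cQ σQ ccQ l hρ h1)))
      (pmem2_smul2MI hS hδ2 (pmem2_kernelPDLI2 hS cQ σQ ccQ l hρ hρ)))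

/-- **The δ-expanded kernel through the three tables**: for `s = s₀ + δ` and duplicate-free `l`,
`K_c[s](u,v) = eval2 T₀ᴿ + δ · eval2 T₁ᴿ + δ² · eval2 T₂ᴿ(δ)` at `(u+v−cc, u−v)`. [folklore] -/
theorem evenKernel_eq_eval2_delta (cQ : ℕ × ℕ → ℚ) (σQ : ℚ) (s₀ ccQ : ℚ) {l : List (ℕ × ℕ)} (hl : l.Nodup)
    (δ u v : ℝ) :
    evenKernel (fun ab => (cQ ab : ℝ)) l.toFinset ((s₀ : ℝ) + δ) (σQ : ℝ) u v =
      eval2 (deltaT0R cQ σQ s₀ ccQ l) (u + v - ccQ) (u - v) +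
        δ * eval2 (deltaT1R cQ σQ s₀ ccQ l) (u + v - ccQ) (u - v) +
          δ ^ 2 * eval2 (deltaT2R cQ σQ s₀ ccQ l δ) (u + v - ccQ) (u - v) := by
  have hsplit : ∀ i, (-1) ^ i * Ring.choose ((s₀ : ℝ) + δ) i = sigC0 s₀ i + δ * sigC1 s₀ i + δ ^ 2 * sigmaRho s₀ i δ :=
    fun i => sigma_eq_split s₀ i δ
  rw [evenKernel_eq_evenKernelG, evenKernelG_delta hsplit]
  simp only [deltaT0R, deltaT1R, deltaT2R, eval2_add2, eval2_smul2, eval2_kernelPDLG _ hl]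
  ring

end Summit.CriticalPhenomena.Ising3D
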